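import Summits.BirchSwinnertonDyer.Rank1Residual.Additive.X4RankZeroCoveredLocusNoLemma20
import HarnessLib

/-!
# X4♯(unit-free) REDUCED TO ITS RESIDUES WITHOUT the Wuthrich-Lemma-20 binder — the end-state map of
# class X4 on EIGHT named facts (cell `b2b-bsdres`, team n1011, seat p14, OWNERS row T-b1 kernel
# piece 3b; sequel of `Additive/X4RankZeroCoveredLocusNoLemma20.lean`)

HONEST FRAMING (cell `b2b-bsdres`, run/shared/lean/b2b/bsd-rank1-residual/, verbatim in every
file): the goal of the cell is to DELETE the COMBINATION-SHAPED residual classes of the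
Birch–Swinnerton-Dyer formula for ALL analytic-rank `≤ 1` elliptic curves over `ℚ` — "full BSD
formula for every rank `≤ 1` curve in class `C`" assembled STRICTLY from published theorems — so
that the rank-`≤ 1` remainder becomes exactly the CONSTRUCTION-SHAPED classes, which are TYPED
(missing-input `Prop`s), NOT attempted. This is not "finishing BSD". Team n1011 (N10 / N11, the
additive block X4 ∧ `p = 3`): research route on the CONSTRUCTION-SHAPED class X4; no claim beyond the
stated classes; the label X4 is UNCHANGED by this file; nothing is booked. Theorems only (no
definition, no named fact minted; every published input is an explicit named-fact hypothesis).

## What this file proves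

Additive-p4's end-state equivalences for the sharpened conjecture X4♯(unit-free)
(`x4SharpUnitFree_iff_lower_and_upperResidue` → `…_residues` → `…_of_casselsTate` (p246470) →
`…_sharp` (p246578) → `…_sharp_exoticFlat` (p249079)) carry `hL20` (Wuthrich 2014 Lemma 20, registry
A9) only through the covered-locus theorem. With the `hL20`-free covered locus of the sibling file
(`X4RankZero.missingUpperBoundAt_of_facts_noL20`) the same proofs go through binder for binder:

* `x4SharpUnitFree_iff_lower_and_upperResidue_noL20`, `x4SharpUnitFree_iff_lower_and_residues_noL20`,
  `x4SharpUnitFree_iff_lower_and_residues_of_casselsTate_noL20`,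
  `x4SharpUnitFree_iff_lower_and_residues_sharp_noL20`,
  **`x4SharpUnitFree_iff_lower_and_residues_sharp_exoticFlat_noL20`**:
  X4♯(unit-free) ⟺ LOWER ∧ EXOTIC♭ ∧ TAM-DEFECT₂♭ ∧ ODD-SHA♭ ∧ MANIN♭ granted EIGHT named facts —
  Cassels–Tate `hCT`, sharp Kato `hKatoS`, Delbourgo Prop. 4 `hDel`, parametrisation data `hmodD`,
  Kato half-eigen `hKatoχ`, Kato component `hK`, + GZK `hGZK` + modularity `hmod` — instead of nine.

Proof bodies are additive-p4's (V22) with `X4RankZero.missingUpperBoundAt_of_facts` ↦ `…_noL20`; no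
statement other than the dropped binder changes. X4 stays CONSTRUCTION-SHAPED; nothing booked.

References: Kato 2004 [Kato2004Asterisque] Thm. 14.5 (3), Thm. 17.4 (3); Delbourgo 1998
[Delbourgo1998] Prop. 4; Cassels 1962 / Silverman *AEC* X.4.14 [SilvermanAEC2009]; Serre 1972
[Serre1972] IV §3.4; Kim 2026 [Kim2022StructureSelmer] Conj. 1.10; Miller 2011 [Miller2011LMS] Def. 1.1.
-/

noncomputable section

open scoped Classical

open WeierstrassCurve Literature.NumberTheory.EllipticCurves
  Literature.NumberTheory.EllipticCurves.ModularForms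
  Literature.NumberTheory.EllipticCurves.Rank1Residual
  Literature.NumberTheory.EllipticCurves.Rank1Residual.Typed

namespace Summit.BirchSwinnertonDyer.Rank1Residual.Additive

/-- **X4♯(unit-free) ⟺ LOWER ∧ UPPER-RESIDUE, without `hL20`** (four named facts + GZK + modularity):
additive-p4's `x4SharpUnitFree_iff_lower_and_upperResidue` with the covered locus served by
`X4RankZero.missingUpperBoundAt_of_facts_noL20`. [cite: Kato2004Asterisque, Thm. 14.5 (3) (p. 236), Thm. 17.4 (3) (p. 273)]
[cite: Delbourgo1998, Prop. 4 (p. 144)] [cite: Miller2011LMS, Def. 1.1] -/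
theorem x4SharpUnitFree_iff_lower_and_upperResidue_noL20
    (hKatoS : Kato2004.rankZero_padicValNat_sha_le_sub_localTamagawa_of_additive_potGood_of_imageContainsSL2)
    (hDel : Delbourgo1998.prop4_rankZero_pow_dvd_constantCoeff)
    (hGZK : rank_eq_analyticRank_of_analyticRank_le_one) (hmod : hasEntireLFunction_rat)
    (hmodD : nonempty_modularParametrizationData)
    (hKatoχ : Wuthrich2014.kato_halfEigenCharIdeal_dvd_cyclotomicPrime_of_surjective) :
    X4SharpUnitFree ↔
      (∀ (W : WeierstrassCurve ℚ) [W.IsElliptic] [W.IsGloballyMinimal] (p : ℕ) [Fact p.Prime],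
          W.analyticRank = 0 → ClassX4 W p → Surj W p → MissingLowerBoundAt W p) ∧
      (∀ (W : WeierstrassCurve ℚ) [W.IsElliptic] [W.IsGloballyMinimal] (p : ℕ) [Fact p.Prime],
          W.analyticRank = 0 → ClassX4 W p → Surj W p → 0 ≤ padicValRat p W.j →
          ¬ ((∀ n : ℕ, W.HasSurjectiveModNGaloisRep (p ^ n : ℕ)) ∧
              padicValNat p W.tamagawaProduct =
                padicValNat p ((W.baseChange ℚ_[p]).localTamagawaNumber ℤ_[p]) ∧
              ∃ (N : ℕ) (_ : NeZero N) (D : ModularParametrizationData W N),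
                ¬ (p : ℤ) ∣ D.maninConstant) →
          MissingUpperBoundAt W p) := by
  constructor
  · intro h
    exact ⟨fun V _ _ p _ hr hX hs ↦ (lower_and_upper_of_missingPPartAt V p (h V p hr hX hs)).1,
      fun V _ _ p _ hr hX hs _ _ ↦ (lower_and_upper_of_missingPPartAt V p (h V p hr hX hs)).2⟩
  · rintro ⟨hlow, hres⟩ V _ _ p _ hr hX hs
    refine missingPPartAt_of_lower_of_upper V p (hlow V p hr hX hs) ?_
    by_cases hj : padicValRat p V.j < 0
    · exact X4RankZero.missingUpperBoundAt_of_facts_noL20 V p hKatoS hDel hGZK hmod hmodD hKatoχ hr hX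
        hs (Or.inl hj)
    · by_cases hcert : (∀ n : ℕ, V.HasSurjectiveModNGaloisRep (p ^ n : ℕ)) ∧
          padicValNat p V.tamagawaProduct =
            padicValNat p ((V.baseChange ℚ_[p]).localTamagawaNumber ℤ_[p]) ∧
          ∃ (N : ℕ) (_ : NeZero N) (D : ModularParametrizationData V N), ¬ (p : ℤ) ∣ D.maninConstant
      · exact X4RankZero.missingUpperBoundAt_of_facts_noL20 V p hKatoS hDel hGZK hmod hmodD hKatoχ hr
          hX hs (Or.inr hcert)
      · exact hres V p hr hX hs (not_lt.mp hj) hcert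

/-- **X4♯(unit-free) ⟺ LOWER ∧ EXOTIC ∧ TAM-DEFECT ∧ MANIN, without `hL20`** — additive-p4's
`x4SharpUnitFree_iff_lower_and_residues`, same proof on the `hL20`-free base equivalence.
[cite: Kato2004Asterisque, Thm. 14.5 (3) (p. 236), Thm. 17.4 (3) (p. 273)] [cite: Delbourgo1998, Prop. 4 (p. 144)]
[cite: Serre1972, IV §3.4] [cite: Kim2022StructureSelmer, Conj. 1.10 (PDF p. 8)] [cite: Miller2011LMS, Def. 1.1] -/
theorem x4SharpUnitFree_iff_lower_and_residues_noL20
    (hKatoS : Kato2004.rankZero_padicValNat_sha_le_sub_localTamagawa_of_additive_potGood_of_imageContainsSL2)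
    (hDel : Delbourgo1998.prop4_rankZero_pow_dvd_constantCoeff)
    (hGZK : rank_eq_analyticRank_of_analyticRank_le_one) (hmod : hasEntireLFunction_rat)
    (hmodD : nonempty_modularParametrizationData)
    (hKatoχ : Wuthrich2014.kato_halfEigenCharIdeal_dvd_cyclotomicPrime_of_surjective) :
    X4SharpUnitFree ↔
      (∀ (W : WeierstrassCurve ℚ) [W.IsElliptic] [W.IsGloballyMinimal] (p : ℕ) [Fact p.Prime],
          W.analyticRank = 0 → ClassX4 W p → Surj W p → MissingLowerBoundAt W p) ∧
      (∀ (W : WeierstrassCurve ℚ) [W.IsElliptic] [W.IsGloballyMinimal],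
          W.analyticRank = 0 → ClassX4 W 3 → Surj W 3 → 0 ≤ padicValRat 3 W.j →
          ¬ (∀ n : ℕ, W.HasSurjectiveModNGaloisRep (3 ^ n : ℕ)) → MissingUpperBoundAt W 3) ∧
      (∀ (W : WeierstrassCurve ℚ) [W.IsElliptic] [W.IsGloballyMinimal] (p : ℕ) [Fact p.Prime],
          W.analyticRank = 0 → ClassX4 W p → Surj W p → 0 ≤ padicValRat p W.j →
          padicValNat p W.tamagawaProduct ≠
            padicValNat p ((W.baseChange ℚ_[p]).localTamagawaNumber ℤ_[p]) →
          MissingUpperBoundAt W p) ∧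
      (∀ (W : WeierstrassCurve ℚ) [W.IsElliptic] [W.IsGloballyMinimal] (p : ℕ) [Fact p.Prime],
          W.analyticRank = 0 → ClassX4 W p → Surj W p → 0 ≤ padicValRat p W.j →
          (∀ (N : ℕ) [NeZero N] (D : ModularParametrizationData W N), (p : ℤ) ∣ D.maninConstant) →
          MissingUpperBoundAt W p) := by
  rw [x4SharpUnitFree_iff_lower_and_upperResidue_noL20 hKatoS hDel hGZK hmod hmodD hKatoχ]
  refine and_congr_right fun _ ↦ ⟨fun hres ↦ ⟨?_, ?_, ?_⟩, ?_⟩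
  · intro V _ _ hr hX hs hj htower
    exact hres V 3 hr hX hs hj fun h ↦ htower h.1
  · intro V _ _ p _ hr hX hs hj htam
    exact hres V p hr hX hs hj fun h ↦ htam h.2.1
  · intro V _ _ p _ hr hX hs hj hnoD
    exact hres V p hr hX hs hj fun ⟨_, _, N, hN, D, hc⟩ ↦ by
      haveI := hN
      exact hc (hnoD N D)
  · rintro ⟨hexotic, htamDefect, hmanin⟩ V _ _ p hpi hr hX hs hj hcert
    by_cases htower : ∀ n : ℕ, V.HasSurjectiveModNGaloisRep (p ^ n : ℕ)
    · by_cases htam : padicValNat p V.tamagawaProduct =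
          padicValNat p ((V.baseChange ℚ_[p]).localTamagawaNumber ℤ_[p])
      · by_cases hD : ∃ (N : ℕ) (_ : NeZero N) (D : ModularParametrizationData V N),
            ¬ (p : ℤ) ∣ D.maninConstant
        · exact absurd ⟨htower, htam, hD⟩ hcert
        · refine hmanin V p hr hX hs hj fun N _ D ↦ ?_
          by_contra hc
          exact hD ⟨N, inferInstance, D, hc⟩
      · exact htamDefect V p hr hX hs hj htam
    · rcases eq_three_or_five_le_of_classX4 V p hX with h3 | h5
      · subst h3
        exact hexotic V hr hX hs hj htower
      · exact absurd (serre_hasSurjectiveModNGaloisRep_pow_holds V p h5 hs) htower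

/-- **X4♯(unit-free) ⟺ LOWER ∧ EXOTIC ∧ TAM-DEFECT₂ ∧ ODD-SHA ∧ MANIN, without `hL20`** (Cassels–Tate
`hCT` + four named facts + GZK + modularity) — additive-p4's `…_of_casselsTate`, same proof.
[cite: Kato2004Asterisque, Thm. 14.5 (3) (p. 236), Thm. 17.4 (3) (p. 273)] [cite: SilvermanAEC2009, Thm. X.4.14]
[cite: Delbourgo1998, Prop. 4 (p. 144)] [cite: Kim2022StructureSelmer, Conj. 1.10 (PDF p. 8)]
[cite: Miller2011LMS, Def. 1.1] -/
theorem x4SharpUnitFree_iff_lower_and_residues_of_casselsTate_noL20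
    (hCT : exists_casselsTate_pairing (K := ℚ))
    (hKatoS : Kato2004.rankZero_padicValNat_sha_le_sub_localTamagawa_of_additive_potGood_of_imageContainsSL2)
    (hDel : Delbourgo1998.prop4_rankZero_pow_dvd_constantCoeff)
    (hGZK : rank_eq_analyticRank_of_analyticRank_le_one) (hmod : hasEntireLFunction_rat)
    (hmodD : nonempty_modularParametrizationData)
    (hKatoχ : Wuthrich2014.kato_halfEigenCharIdeal_dvd_cyclotomicPrime_of_surjective) :
    X4SharpUnitFree ↔
      (∀ (W : WeierstrassCurve ℚ) [W.IsElliptic] [W.IsGloballyMinimal] (p : ℕ) [Fact p.Prime],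
          W.analyticRank = 0 → ClassX4 W p → Surj W p → MissingLowerBoundAt W p) ∧
      (∀ (W : WeierstrassCurve ℚ) [W.IsElliptic] [W.IsGloballyMinimal],
          W.analyticRank = 0 → ClassX4 W 3 → Surj W 3 → 0 ≤ padicValRat 3 W.j →
          ¬ (∀ n : ℕ, W.HasSurjectiveModNGaloisRep (3 ^ n : ℕ)) → MissingUpperBoundAt W 3) ∧
      (∀ (W : WeierstrassCurve ℚ) [W.IsElliptic] [W.IsGloballyMinimal] (p : ℕ) [Fact p.Prime],
          W.analyticRank = 0 → ClassX4 W p → Surj W p → 0 ≤ padicValRat p W.j →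
          padicValNat p ((W.baseChange ℚ_[p]).localTamagawaNumber ℤ_[p]) + 2 ≤
            padicValNat p W.tamagawaProduct →
          MissingUpperBoundAt W p) ∧
      (∀ (W : WeierstrassCurve ℚ) [W.IsElliptic] [W.IsGloballyMinimal] (p : ℕ) [Fact p.Prime],
          W.analyticRank = 0 → ClassX4 W p → Surj W p → 0 ≤ padicValRat p W.j →
          (∃ q : ℚ, shaAn W = (q : ℂ) ∧ Odd (padicValRat p q)) → MissingUpperBoundAt W p) ∧
      (∀ (W : WeierstrassCurve ℚ) [W.IsElliptic] [W.IsGloballyMinimal] (p : ℕ) [Fact p.Prime],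
          W.analyticRank = 0 → ClassX4 W p → Surj W p → 0 ≤ padicValRat p W.j →
          (∀ (N : ℕ) [NeZero N] (D : ModularParametrizationData W N), (p : ℤ) ∣ D.maninConstant) →
          MissingUpperBoundAt W p) := by
  rw [x4SharpUnitFree_iff_lower_and_residues_noL20 hKatoS hDel hGZK hmod hmodD hKatoχ]
  refine and_congr_right fun _ ↦ and_congr_right fun hexotic ↦ ⟨fun ⟨htam, hmanin⟩ ↦ ⟨?_, ?_, hmanin⟩, ?_⟩
  · intro V _ _ p _ hr hX hs hj h2
    exact htam V p hr hX hs hj (by omega)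
  · intro V _ _ p _ hr hX hs hj ⟨q, hq, hodd⟩
    by_cases htamEq : padicValNat p V.tamagawaProduct =
        padicValNat p ((V.baseChange ℚ_[p]).localTamagawaNumber ℤ_[p])
    · by_cases htower : ∀ n : ℕ, V.HasSurjectiveModNGaloisRep (p ^ n : ℕ)
      · by_cases hD : ∃ (N : ℕ) (_ : NeZero N) (D : ModularParametrizationData V N),
            ¬ (p : ℤ) ∣ D.maninConstant
        · obtain ⟨N, hN, D, hc⟩ := hD
          haveI := hN
          exact X4RankZero.missingUpperBoundAt_of_katoSharp V p hKatoS hGZK hmod hr hX hj htower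
            htamEq D hc
        · refine hmanin V p hr hX hs hj fun N _ D ↦ ?_
          by_contra hc
          exact hD ⟨N, inferInstance, D, hc⟩
      · rcases eq_three_or_five_le_of_classX4 V p hX with h3 | h5
        · subst h3
          exact hexotic V hr hX hs hj htower
        · exact absurd (serre_hasSurjectiveModNGaloisRep_pow_holds V p h5 hs) htower
    · exact htam V p hr hX hs hj htamEq
  · rintro ⟨htam2, hoddSha, hmanin⟩
    refine ⟨?_, hmanin⟩
    intro V _ _ p _ hr hX hs hj htamNe
    by_cases htower : ∀ n : ℕ, V.HasSurjectiveModNGaloisRep (p ^ n : ℕ)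
    · by_cases hD : ∃ (N : ℕ) (_ : NeZero N) (D : ModularParametrizationData V N),
          ¬ (p : ℤ) ∣ D.maninConstant
      · obtain ⟨N, hN, D, hc⟩ := hD
        haveI := hN
        obtain ⟨q, hq, hle⟩ :=
          X4RankZero.padicValNat_shaOrder_le_of_katoSharp V p hKatoS hGZK hmod hr hX hj htower D hc
        by_cases h1 : padicValNat p V.tamagawaProduct ≤
            padicValNat p ((V.baseChange ℚ_[p]).localTamagawaNumber ℤ_[p]) + 1
        · rcases Int.even_or_odd (padicValRat p q) with heven | hodd
          · exact X4RankZero.missingUpperBoundAt_of_katoSharp_of_casselsTate_of_tamDefect_le_one_of_even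
              V p hCT hKatoS hGZK hmod hr hX hj htower D hc h1 hq heven
          · exact hoddSha V p hr hX hs hj ⟨q, hq, hodd⟩
        · exact htam2 V p hr hX hs hj (by omega)
      · refine hmanin V p hr hX hs hj fun N _ D ↦ ?_
        by_contra hc
        exact hD ⟨N, inferInstance, D, hc⟩
    · rcases eq_three_or_five_le_of_classX4 V p hX with h3 | h5
      · subst h3
        exact hexotic V hr hX hs hj htower
      · exact absurd (serre_hasSurjectiveModNGaloisRep_pow_holds V p h5 hs) htower

/-- **X4♯(unit-free) ⟺ LOWER ∧ EXOTIC ∧ TAM-DEFECT₂♭ ∧ ODD-SHA♭ ∧ MANIN♭, without `hL20`** (EIGHT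
named facts: `hCT hKatoS hDel hGZK hmod hmodD hKatoχ hK`) — additive-p4's `…_sharp` (p246578), same
proof on the `hL20`-free Cassels–Tate form; the (G-ord, `e = 2`) rows leave the three upper-residue
pieces by `ClassX4Gord.missingUpperBoundAt_rankZero_of_katoComponent_of_surj` (p249079).
[cite: Kato2004Asterisque, Thm. 14.5 (3) (p. 236), Thm. 17.4 (3) (p. 273)] [cite: Delbourgo1998, Prop. 4 (p. 144)]
[cite: SilvermanAEC2009, Thm. X.4.14] [cite: Kim2022StructureSelmer, Conj. 1.10 (PDF p. 8)] [cite: Miller2011LMS, Def. 1.1] -/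
theorem x4SharpUnitFree_iff_lower_and_residues_sharp_noL20
    (hCT : exists_casselsTate_pairing (K := ℚ))
    (hKatoS : Kato2004.rankZero_padicValNat_sha_le_sub_localTamagawa_of_additive_potGood_of_imageContainsSL2)
    (hDel : Delbourgo1998.prop4_rankZero_pow_dvd_constantCoeff)
    (hGZK : rank_eq_analyticRank_of_analyticRank_le_one) (hmod : hasEntireLFunction_rat)
    (hmodD : nonempty_modularParametrizationData)
    (hKatoχ : Wuthrich2014.kato_halfEigenCharIdeal_dvd_cyclotomicPrime_of_surjective)
    (hK : Kato2004.charIdeal_dvd_padicLFunctionBranch_component_of_surjective) :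
    X4SharpUnitFree ↔
      (∀ (W : WeierstrassCurve ℚ) [W.IsElliptic] [W.IsGloballyMinimal] (p : ℕ) [Fact p.Prime],
          W.analyticRank = 0 → ClassX4 W p → Surj W p → MissingLowerBoundAt W p) ∧
      (∀ (W : WeierstrassCurve ℚ) [W.IsElliptic] [W.IsGloballyMinimal],
          W.analyticRank = 0 → ClassX4 W 3 → Surj W 3 → 0 ≤ padicValRat 3 W.j →
          ¬ (∀ n : ℕ, W.HasSurjectiveModNGaloisRep (3 ^ n : ℕ)) → MissingUpperBoundAt W 3) ∧
      (∀ (W : WeierstrassCurve ℚ) [W.IsElliptic] [W.IsGloballyMinimal] (p : ℕ) [Fact p.Prime],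
          W.analyticRank = 0 → ClassX4 W p → Surj W p → 0 ≤ padicValRat p W.j →
          ¬ (TypeGOrd W p ∧ semistabilityIndex W p = 2) →
          padicValNat p ((W.baseChange ℚ_[p]).localTamagawaNumber ℤ_[p]) + 2 ≤
            padicValNat p W.tamagawaProduct →
          MissingUpperBoundAt W p) ∧
      (∀ (W : WeierstrassCurve ℚ) [W.IsElliptic] [W.IsGloballyMinimal] (p : ℕ) [Fact p.Prime],
          W.analyticRank = 0 → ClassX4 W p → Surj W p → 0 ≤ padicValRat p W.j →
          ¬ (TypeGOrd W p ∧ semistabilityIndex W p = 2) →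
          (∃ q : ℚ, shaAn W = (q : ℂ) ∧ Odd (padicValRat p q)) → MissingUpperBoundAt W p) ∧
      (∀ (W : WeierstrassCurve ℚ) [W.IsElliptic] [W.IsGloballyMinimal] (p : ℕ) [Fact p.Prime],
          W.analyticRank = 0 → ClassX4 W p → Surj W p → 0 ≤ padicValRat p W.j →
          ¬ (TypeGOrd W p ∧ semistabilityIndex W p = 2) →
          (∀ (N : ℕ) [NeZero N] (D : ModularParametrizationData W N), (p : ℤ) ∣ D.maninConstant) →
          MissingUpperBoundAt W p) := by
  rw [x4SharpUnitFree_iff_lower_and_residues_of_casselsTate_noL20 hCT hKatoS hDel hGZK hmod hmodD hKatoχ]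
  refine and_congr_right fun _ ↦ and_congr_right fun _ ↦ ?_
  constructor
  · rintro ⟨htam, hodd, hmanin⟩
    exact ⟨fun V _ _ p _ hr hX hs hj _ h2 ↦ htam V p hr hX hs hj h2,
      fun V _ _ p _ hr hX hs hj _ ho ↦ hodd V p hr hX hs hj ho,
      fun V _ _ p _ hr hX hs hj _ hD ↦ hmanin V p hr hX hs hj hD⟩
  · rintro ⟨htam, hodd, hmanin⟩
    refine ⟨fun V _ _ p _ hr hX hs hj h2 ↦ ?_, fun V _ _ p _ hr hX hs hj ho ↦ ?_,
      fun V _ _ p _ hr hX hs hj hD ↦ ?_⟩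
    · by_cases hG : TypeGOrd V p ∧ semistabilityIndex V p = 2
      · exact ClassX4Gord.missingUpperBoundAt_rankZero_of_katoComponent_of_surj hK hDel hGZK hmod hmodD
          ⟨hX, hG.1⟩ hG.2 hr hs
      · exact htam V p hr hX hs hj hG h2
    · by_cases hG : TypeGOrd V p ∧ semistabilityIndex V p = 2
      · exact ClassX4Gord.missingUpperBoundAt_rankZero_of_katoComponent_of_surj hK hDel hGZK hmod hmodD
          ⟨hX, hG.1⟩ hG.2 hr hs
      · exact hodd V p hr hX hs hj hG ho
    · by_cases hG : TypeGOrd V p ∧ semistabilityIndex V p = 2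
      · exact ClassX4Gord.missingUpperBoundAt_rankZero_of_katoComponent_of_surj hK hDel hGZK hmod hmodD
          ⟨hX, hG.1⟩ hG.2 hr hs
      · exact hmanin V p hr hX hs hj hG hD

/-- **THE END-STATE OF CLASS X4 ON EIGHT NAMED FACTS: X4♯(unit-free) ⟺ LOWER ∧ EXOTIC♭ ∧
TAM-DEFECT₂♭ ∧ ODD-SHA♭ ∧ MANIN♭, without `hL20`** — the EXOTIC piece also restricted to the rows
that are not (G-ord, `e = 2`) (`exotic_iff_exotic_of_not_typeGOrd_two`, p249079). Binders: `hCT`,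
`hKatoS`, `hDel`, `hGZK`, `hmod`, `hmodD`, `hKatoχ`, `hK`. [cite: Kato2004Asterisque, Thm. 14.5 (3) (p. 236), Thm. 17.4 (3) (p. 273)]
[cite: Delbourgo1998, Prop. 4 (p. 144)] [cite: SilvermanAEC2009, Thm. X.4.14]
[cite: Kim2022StructureSelmer, Conj. 1.10 (PDF p. 8)] [cite: Miller2011LMS, Def. 1.1] -/
theorem x4SharpUnitFree_iff_lower_and_residues_sharp_exoticFlat_noL20
    (hCT : exists_casselsTate_pairing (K := ℚ))
    (hKatoS : Kato2004.rankZero_padicValNat_sha_le_sub_localTamagawa_of_additive_potGood_of_imageContainsSL2)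
    (hDel : Delbourgo1998.prop4_rankZero_pow_dvd_constantCoeff)
    (hGZK : rank_eq_analyticRank_of_analyticRank_le_one) (hmod : hasEntireLFunction_rat)
    (hmodD : nonempty_modularParametrizationData)
    (hKatoχ : Wuthrich2014.kato_halfEigenCharIdeal_dvd_cyclotomicPrime_of_surjective)
    (hK : Kato2004.charIdeal_dvd_padicLFunctionBranch_component_of_surjective) :
    X4SharpUnitFree ↔
      (∀ (W : WeierstrassCurve ℚ) [W.IsElliptic] [W.IsGloballyMinimal] (p : ℕ) [Fact p.Prime],
          W.analyticRank = 0 → ClassX4 W p → Surj W p → MissingLowerBoundAt W p) ∧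
      (∀ (W : WeierstrassCurve ℚ) [W.IsElliptic] [W.IsGloballyMinimal],
          W.analyticRank = 0 → ClassX4 W 3 → Surj W 3 → 0 ≤ padicValRat 3 W.j →
          ¬ (TypeGOrd W 3 ∧ semistabilityIndex W 3 = 2) →
          ¬ (∀ n : ℕ, W.HasSurjectiveModNGaloisRep (3 ^ n : ℕ)) → MissingUpperBoundAt W 3) ∧
      (∀ (W : WeierstrassCurve ℚ) [W.IsElliptic] [W.IsGloballyMinimal] (p : ℕ) [Fact p.Prime],
          W.analyticRank = 0 → ClassX4 W p → Surj W p → 0 ≤ padicValRat p W.j →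
          ¬ (TypeGOrd W p ∧ semistabilityIndex W p = 2) →
          padicValNat p ((W.baseChange ℚ_[p]).localTamagawaNumber ℤ_[p]) + 2 ≤
            padicValNat p W.tamagawaProduct →
          MissingUpperBoundAt W p) ∧
      (∀ (W : WeierstrassCurve ℚ) [W.IsElliptic] [W.IsGloballyMinimal] (p : ℕ) [Fact p.Prime],
          W.analyticRank = 0 → ClassX4 W p → Surj W p → 0 ≤ padicValRat p W.j →
          ¬ (TypeGOrd W p ∧ semistabilityIndex W p = 2) →
          (∃ q : ℚ, shaAn W = (q : ℂ) ∧ Odd (padicValRat p q)) → MissingUpperBoundAt W p) ∧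
      (∀ (W : WeierstrassCurve ℚ) [W.IsElliptic] [W.IsGloballyMinimal] (p : ℕ) [Fact p.Prime],
          W.analyticRank = 0 → ClassX4 W p → Surj W p → 0 ≤ padicValRat p W.j →
          ¬ (TypeGOrd W p ∧ semistabilityIndex W p = 2) →
          (∀ (N : ℕ) [NeZero N] (D : ModularParametrizationData W N), (p : ℤ) ∣ D.maninConstant) →
          MissingUpperBoundAt W p) := by
  rw [x4SharpUnitFree_iff_lower_and_residues_sharp_noL20 hCT hKatoS hDel hGZK hmod hmodD hKatoχ hK,
    exotic_iff_exotic_of_not_typeGOrd_two]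

end Summit.BirchSwinnertonDyer.Rank1Residual.Additive

end
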